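import Literature.Barriers.CriticalPhenomena.PlaquetteWalkHoleRootCutMarking
import HarnessLib

/-!
# Barrier catalogue (SAWScalingLimit): THE MARKING LAW FOR THE OVER ROUTE — `K_N2` and `K_N1` on a wall or above a shut column
double `rootN` / `farNW`, by the row mirror

Leaf of `PlaquetteWalkHoleRootCutMarking` (the marking law and LAW L's two UNDER-route kills for general domains: `K_S1` doubles
`rootS` through its `θ`-corners, `K_S2` doubles `farSW` through its `(π − θ)`-corners). Setting as there. This file states the
under-route kills in WOUND form with the kind list as conclusion (§1, either orientation of the winding witness) and transports
them through the reflection in the root row (`ΩG.mirrorFar`, `kindsIn_eq_coCorner_of_mirrorFar_corner`,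
`kindsIn_eq_corner_of_mirrorFar_coCorner`) to the OVER route (§2): ★★★★★ `ΩG.kindsIn_rootN_eq_of_wound_over_killNE_column` /
`…_eastWall` — hole and `K_N2 = killNE w = (w.1 + 1, w.2 + 2)` absent, the west sides of column `w.1 + 1` dead from the kill row up
to a ceiling (or the east wall two columns beyond the hole) ⇒ every wound class-`B2a` OVER-walk doubles `rootN w` through its two
`(π − θ)`-corners (`w₂`-kill: `ΩG.not_W2FreeOff_farW_of_wound_over_killNE_column/eastWall`); ★★★★★
`ΩG.kindsIn_farNW_eq_of_wound_over_killNW_column` / `…_westWall` — `K_N1 = killNW w = (w.1 − 3, w.2 + 2)` absent, the far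
cell's column shut above the kill row up to a ceiling (or the west wall) ⇒ every wound over-walk doubles `farNW w` through its two
`θ`-corners (`w₁`-kill: `ΩG.not_W1FreeOff_farW_of_wound_over_killNW_column/westWall`). §3 Boxes, ANY further defects `S ∋ h`
missing the far cell: `lawL_box_killNE_wall_over_w2_killed` (`K_N2 = (h.1 + 2, h.2 + 2)` removed with `h.2 + 3 = n` or
`h.1 + 3 = m`), `lawL_box_killNW_wall_over_w1_killed` (`K_N1 = (h.1 − 2, h.2 + 2)` removed with `h.2 + 3 = n` or `h.1 = 2`) — with
the parent's §5, all four rows of the lane's LAW L (`PlaquetteWalkHoleRootLawLDichotomy`: the (⇐) halves of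
`lawL_box_under_w1/w2_killed_iff`, `lawL_box_over_w1/w2_killed_iff`) hold for EVERY defect list, from the cut law alone.

Not in print; venture lane «pcv-sawmu», seat b-step0 gen 29 (FINDING-YB-KILL-FORCED-ZEROS §28).

References: A. Glazman, I. Manolescu, arXiv:1708.00395v3, §1 (Fig. 1, Fig. 2, the remark after eq. (1)), §2.1, §4.2 (lattice
symmetries), Lemma 2.1 [GlazmanManolescu2019]; A. Glazman, Electron. Commun. Probab. 20 (2015) no. 86, Lemma 3.1, proof pp. 6–7
[Glazman2015WeightedSAW]; R. Courant, H. Robbins, *What is Mathematics?* (1941/1958), Ch. V Appendix §2 (the even–odd rule)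
[CourantRobbins1958].
-/

noncomputable section

open Set Function Complex
open Literature.Topology.PlaneTopology

namespace Literature.Probability.RandomPlanarGeometry.SAW.YangBaxter

open Real
open Literature.Barriers.CriticalPhenomena.PlaquetteWalk (mirrorRowFace)

namespace ΩG

variable {D : Set Face} {w : Face}

/-! ## §1 The under-route kills in wound form, with the kind list as conclusion -/

/-- The reversed companion of a wound walk has the same kinds off the far cell: a `[κ, κ]` list transports.
[cite: GlazmanManolescu2019, §2.1 (walks and their reversals)] -/
private theorem kindsIn_eq_pair_of_rev' (ω : ΩG D (w.side .W) (farW w)) (hr : RootedFace D (w.side .W) (farW w))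
    (h : ω.IsB2a) {g : Face} (hg : g ≠ farW w) {κ : ArcKind} (hk : (ω.rev hr).2.kindsIn g = [κ, κ]) :
    ω.2.kindsIn g = [κ, κ] := by
  have hperm := ω.kindsIn_rev_perm hr h hg
  rw [hk] at hperm
  have hp : (ω.2.kindsIn g).Perm (List.replicate 2 κ) := hperm.symm
  exact List.perm_replicate.1 hp

/-- ★★★★ **`K_S1`, column shut below: every WOUND under-walk has `kindsIn (rootS w) = [corner, corner]`** (either orientation).
[cite: GlazmanManolescu2019, §1, Fig. 1 and the remark after eq. (1)]
[cite: Glazman2015WeightedSAW, Lemma 3.1 (proof, pp. 6–7)] [cite: CourantRobbins1958, Ch. V Appendix §2 (the even–odd rule)] -/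
theorem kindsIn_rootS_eq_of_wound_under_killSE_column (hh : holeFaceW w ∉ D) (hK : killSE w ∉ D) {Y : ℤ}
    (hY : Y ≤ w.2 - 2) (hcol : ∀ y : ℤ, Y ≤ y → y ≤ w.2 - 3 → ((w.1, y) : Face) ∉ D ∨ ((w.1 + 1, y) : Face) ∉ D)
    (hfloor : ∀ f : Face, f ∈ D → Y ≤ f.2)
    (ω : ΩG D (w.side .W) (farW w)) (hr : RootedFace D (w.side .W) (farW w)) (h : ω.IsB2a)
    (hS : ω.2.firstSideG = .S) {θ : ℝ}
    (hW : ω.WE (fun _ => θ) ≠ excursionWinding θ ω.2.firstSideG (ω.z1 hr h) ω.1) :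
    ω.2.kindsIn (rootS w) = [.corner, .corner] := by
  rcases ω.AJ_ne_zero_or_rev_of_wound hr h θ hW with hA | hA
  · exact kindsIn_rootS_eq_of_AJ_ne_zero_under_killSE_column hh hK hY hcol hfloor ω hr h hS hA
  · have h' := ω.rev_isB2a hr h
    have hS' : (ω.rev hr).2.firstSideG = .S := by rw [ω.rev_firstSide hr h]; exact hS
    exact kindsIn_eq_pair_of_rev' ω hr h (rootS_ne_farW w)
      (kindsIn_rootS_eq_of_AJ_ne_zero_under_killSE_column hh hK hY hcol hfloor (ω.rev hr) hr h' hS' hA)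

/-- ★★★★ **`K_S1` on the east wall: every WOUND under-walk has `kindsIn (rootS w) = [corner, corner]`** (either orientation).
[cite: GlazmanManolescu2019, §1, Fig. 1 and the remark after eq. (1)]
[cite: Glazman2015WeightedSAW, Lemma 3.1 (proof, pp. 6–7)] [cite: CourantRobbins1958, Ch. V Appendix §2 (the even–odd rule)] -/
theorem kindsIn_rootS_eq_of_wound_under_killSE_eastWall (hh : holeFaceW w ∉ D) (hK : killSE w ∉ D)
    (heast : ∀ f : Face, f ∈ D → f.1 < w.1 + 2)
    (ω : ΩG D (w.side .W) (farW w)) (hr : RootedFace D (w.side .W) (farW w)) (h : ω.IsB2a)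
    (hS : ω.2.firstSideG = .S) {θ : ℝ}
    (hW : ω.WE (fun _ => θ) ≠ excursionWinding θ ω.2.firstSideG (ω.z1 hr h) ω.1) :
    ω.2.kindsIn (rootS w) = [.corner, .corner] := by
  rcases ω.AJ_ne_zero_or_rev_of_wound hr h θ hW with hA | hA
  · exact kindsIn_rootS_eq_of_AJ_ne_zero_under_killSE_eastWall hh hK heast ω hr h hS hA
  · have h' := ω.rev_isB2a hr h
    have hS' : (ω.rev hr).2.firstSideG = .S := by rw [ω.rev_firstSide hr h]; exact hS
    exact kindsIn_eq_pair_of_rev' ω hr h (rootS_ne_farW w)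
      (kindsIn_rootS_eq_of_AJ_ne_zero_under_killSE_eastWall hh hK heast (ω.rev hr) hr h' hS' hA)

/-- ★★★★ **`K_S2`, column shut below: every WOUND under-walk has `kindsIn (farSW w) = [coCorner, coCorner]`** (either orientation).
[cite: GlazmanManolescu2019, §1, Fig. 2 («if θ = π/3, then w₂ = 0»)]
[cite: Glazman2015WeightedSAW, Lemma 3.1 (proof, pp. 6–7)] [cite: CourantRobbins1958, Ch. V Appendix §2 (the even–odd rule)] -/
theorem kindsIn_farSW_eq_of_wound_under_killSW_column (hh : holeFaceW w ∉ D) (hK : killSW w ∉ D) {Y : ℤ}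
    (hY : Y ≤ w.2 - 2) (hcol : ∀ y : ℤ, Y ≤ y → y ≤ w.2 - 3 → ((w.1 - 3, y) : Face) ∉ D ∨ ((w.1 - 2, y) : Face) ∉ D)
    (hfloor : ∀ f : Face, f ∈ D → Y ≤ f.2)
    (ω : ΩG D (w.side .W) (farW w)) (hr : RootedFace D (w.side .W) (farW w)) (h : ω.IsB2a)
    (hS : ω.2.firstSideG = .S) {θ : ℝ}
    (hW : ω.WE (fun _ => θ) ≠ excursionWinding θ ω.2.firstSideG (ω.z1 hr h) ω.1) :
    ω.2.kindsIn (farSW w) = [.coCorner, .coCorner] := by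
  rcases ω.AJ_ne_zero_or_rev_of_wound hr h θ hW with hA | hA
  · exact kindsIn_farSW_eq_of_AJ_ne_zero_under_killSW_column hh hK hY hcol hfloor ω hr h hS hA
  · have h' := ω.rev_isB2a hr h
    have hS' : (ω.rev hr).2.firstSideG = .S := by rw [ω.rev_firstSide hr h]; exact hS
    exact kindsIn_eq_pair_of_rev' ω hr h (farSW_ne_farW w)
      (kindsIn_farSW_eq_of_AJ_ne_zero_under_killSW_column hh hK hY hcol hfloor (ω.rev hr) hr h' hS' hA)

/-- ★★★★ **`K_S2` on the west wall: every WOUND under-walk has `kindsIn (farSW w) = [coCorner, coCorner]`** (either orientation).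
[cite: GlazmanManolescu2019, §1, Fig. 2 («if θ = π/3, then w₂ = 0»)]
[cite: Glazman2015WeightedSAW, Lemma 3.1 (proof, pp. 6–7)] [cite: CourantRobbins1958, Ch. V Appendix §2 (the even–odd rule)] -/
theorem kindsIn_farSW_eq_of_wound_under_killSW_westWall (hh : holeFaceW w ∉ D) (hK : killSW w ∉ D)
    (hwest : ∀ f : Face, f ∈ D → w.1 - 3 ≤ f.1)
    (ω : ΩG D (w.side .W) (farW w)) (hr : RootedFace D (w.side .W) (farW w)) (h : ω.IsB2a)
    (hS : ω.2.firstSideG = .S) {θ : ℝ}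
    (hW : ω.WE (fun _ => θ) ≠ excursionWinding θ ω.2.firstSideG (ω.z1 hr h) ω.1) :
    ω.2.kindsIn (farSW w) = [.coCorner, .coCorner] := by
  rcases ω.AJ_ne_zero_or_rev_of_wound hr h θ hW with hA | hA
  · exact kindsIn_farSW_eq_of_AJ_ne_zero_under_killSW_westWall hh hK hwest ω hr h hS hA
  · have h' := ω.rev_isB2a hr h
    have hS' : (ω.rev hr).2.firstSideG = .S := by rw [ω.rev_firstSide hr h]; exact hS
    exact kindsIn_eq_pair_of_rev' ω hr h (farSW_ne_farW w)
      (kindsIn_farSW_eq_of_AJ_ne_zero_under_killSW_westWall hh hK hwest (ω.rev hr) hr h' hS' hA)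

/-! ## §2 The row-mirror twins: `K_N2` doubles `rootN`, `K_N1` doubles `farNW` -/

/-- The reflection in the root row on a cell, in coordinates. [cite: GlazmanManolescu2019, §4.2 (lattice symmetries)] -/
private theorem mirrorRowFace_mkMO (w : Face) (x y : ℤ) : mirrorRowFace w.2 ((x, y) : Face) = (x, 2 * w.2 - y) := by
  simp [mirrorRowFace]

/-- ★★★★★ **`K_N2` WITH THE COLUMN ABOVE IT SHUT ⇒ EVERY WOUND OVER-WALK DOUBLES `rootN` THROUGH ITS TWO `(π − θ)`-CORNERS.** Hole and
`killNE w = (w.1 + 1, w.2 + 2)` absent; for some ceiling row `Y ≥ w.2 + 2`, no face of `D` above row `Y` and every west side of column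
`w.1 + 1` in the rows `w.2 + 3, …, Y` dead. Then every wound class-`B2a` OVER-walk (first side `N`) has
`kindsIn (rootN w) = [coCorner, coCorner]` (`w₂`-kill: the weight vanishes at `θ = π/3`).
[cite: GlazmanManolescu2019, §1, Fig. 1, Fig. 2 («if θ = π/3, then w₂ = 0»), §4.2 (lattice symmetries)]
[cite: Glazman2015WeightedSAW, Lemma 3.1 (proof, pp. 6–7)] [cite: CourantRobbins1958, Ch. V Appendix §2 (the even–odd rule)] -/
theorem kindsIn_rootN_eq_of_wound_over_killNE_column (hh : holeFaceW w ∉ D) (hK : killNE w ∉ D) {Y : ℤ}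
    (hY : w.2 + 2 ≤ Y) (hcol : ∀ y : ℤ, w.2 + 3 ≤ y → y ≤ Y → ((w.1, y) : Face) ∉ D ∨ ((w.1 + 1, y) : Face) ∉ D)
    (hceil : ∀ f : Face, f ∈ D → f.2 ≤ Y)
    (ω : ΩG D (w.side .W) (farW w)) (hr : RootedFace D (w.side .W) (farW w)) (h : ω.IsB2a)
    (hN : ω.2.firstSideG = .N) {θ : ℝ}
    (hW : ω.WE (fun _ => θ) ≠ excursionWinding θ ω.2.firstSideG (ω.z1 hr h) ω.1) :
    ω.2.kindsIn (rootN w) = [.coCorner, .coCorner] := by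
  have hr' := rootedFace_rowMirrorDom w hr
  have h' := ω.mirrorFar_isB2a hr h
  have hh' : holeFaceW w ∉ rowMirrorDom w D := by rwa [mem_rowMirrorDom, mirrorRowFace_holeFaceW]
  have hK' : killSE w ∉ rowMirrorDom w D := by rwa [mem_rowMirrorDom, mirrorRowFace_killSE]
  have hcol' : ∀ y : ℤ, 2 * w.2 - Y ≤ y → y ≤ w.2 - 3 →
      ((w.1, y) : Face) ∉ rowMirrorDom w D ∨ ((w.1 + 1, y) : Face) ∉ rowMirrorDom w D := by
    intro y hy1 hy2
    rw [mem_rowMirrorDom, mem_rowMirrorDom, mirrorRowFace_mkMO, mirrorRowFace_mkMO]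
    exact hcol (2 * w.2 - y) (by omega) (by omega)
  have hfloor' : ∀ f : Face, f ∈ rowMirrorDom w D → 2 * w.2 - Y ≤ f.2 := by
    intro f hf
    rw [mem_rowMirrorDom] at hf
    have := hceil _ hf
    obtain ⟨x, y⟩ := f
    rw [mirrorRowFace_mkMO] at this
    simp only at this ⊢
    omega
  have hS' : ω.mirrorFar.2.firstSideG = .S := by rw [mirrorFar_firstSideG, hN]; rfl
  have hk := kindsIn_rootS_eq_of_wound_under_killSE_column hh' hK' (Y := 2 * w.2 - Y) (by omega) hcol' hfloor'
    ω.mirrorFar hr' h' hS' (ω.mirrorFar_wound hr h hW)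
  have hk2 := ω.kindsIn_eq_coCorner_of_mirrorFar_corner hk
  rwa [mirrorRowFace_rootS] at hk2

/-- ★★★★★ **`K_N2` ON THE EAST WALL ⇒ EVERY WOUND OVER-WALK DOUBLES `rootN` THROUGH ITS TWO `(π − θ)`-CORNERS** (hole and `killNE w`
absent, no face of `D` in the columns `≥ w.1 + 2`). [cite: GlazmanManolescu2019, §1, Fig. 2, §4.2 (lattice symmetries)]
[cite: Glazman2015WeightedSAW, Lemma 3.1 (proof, pp. 6–7)] [cite: CourantRobbins1958, Ch. V Appendix §2 (the even–odd rule)] -/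
theorem kindsIn_rootN_eq_of_wound_over_killNE_eastWall (hh : holeFaceW w ∉ D) (hK : killNE w ∉ D)
    (heast : ∀ f : Face, f ∈ D → f.1 < w.1 + 2)
    (ω : ΩG D (w.side .W) (farW w)) (hr : RootedFace D (w.side .W) (farW w)) (h : ω.IsB2a)
    (hN : ω.2.firstSideG = .N) {θ : ℝ}
    (hW : ω.WE (fun _ => θ) ≠ excursionWinding θ ω.2.firstSideG (ω.z1 hr h) ω.1) :
    ω.2.kindsIn (rootN w) = [.coCorner, .coCorner] := by
  have hr' := rootedFace_rowMirrorDom w hr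
  have h' := ω.mirrorFar_isB2a hr h
  have hh' : holeFaceW w ∉ rowMirrorDom w D := by rwa [mem_rowMirrorDom, mirrorRowFace_holeFaceW]
  have hK' : killSE w ∉ rowMirrorDom w D := by rwa [mem_rowMirrorDom, mirrorRowFace_killSE]
  have heast' : ∀ f : Face, f ∈ rowMirrorDom w D → f.1 < w.1 + 2 := by
    intro f hf
    rw [mem_rowMirrorDom] at hf
    have := heast _ hf
    obtain ⟨x, y⟩ := f
    rw [mirrorRowFace_mkMO] at this
    exact this
  have hS' : ω.mirrorFar.2.firstSideG = .S := by rw [mirrorFar_firstSideG, hN]; rfl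
  have hk := kindsIn_rootS_eq_of_wound_under_killSE_eastWall hh' hK' heast' ω.mirrorFar hr' h' hS'
    (ω.mirrorFar_wound hr h hW)
  have hk2 := ω.kindsIn_eq_coCorner_of_mirrorFar_corner hk
  rwa [mirrorRowFace_rootS] at hk2

/-- ★★★★★ **`K_N1` WITH THE COLUMN ABOVE IT SHUT ⇒ EVERY WOUND OVER-WALK DOUBLES `farNW` THROUGH ITS TWO `θ`-CORNERS.** Hole and
`killNW w = (w.1 − 3, w.2 + 2)` absent; for some ceiling row `Y ≥ w.2 + 2`, no face of `D` above row `Y` and every west side of the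
far cell's column `w.1 − 2` in the rows `w.2 + 3, …, Y` dead. Then every wound class-`B2a` OVER-walk has
`kindsIn (farNW w) = [corner, corner]` (`w₁`-kill: the weight vanishes at `θ = 2π/3`).
[cite: GlazmanManolescu2019, §1, Fig. 1 and the remark after eq. (1), §4.2 (lattice symmetries)]
[cite: Glazman2015WeightedSAW, Lemma 3.1 (proof, pp. 6–7)] [cite: CourantRobbins1958, Ch. V Appendix §2 (the even–odd rule)] -/
theorem kindsIn_farNW_eq_of_wound_over_killNW_column (hh : holeFaceW w ∉ D) (hK : killNW w ∉ D) {Y : ℤ}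
    (hY : w.2 + 2 ≤ Y) (hcol : ∀ y : ℤ, w.2 + 3 ≤ y → y ≤ Y → ((w.1 - 3, y) : Face) ∉ D ∨ ((w.1 - 2, y) : Face) ∉ D)
    (hceil : ∀ f : Face, f ∈ D → f.2 ≤ Y)
    (ω : ΩG D (w.side .W) (farW w)) (hr : RootedFace D (w.side .W) (farW w)) (h : ω.IsB2a)
    (hN : ω.2.firstSideG = .N) {θ : ℝ}
    (hW : ω.WE (fun _ => θ) ≠ excursionWinding θ ω.2.firstSideG (ω.z1 hr h) ω.1) :
    ω.2.kindsIn (farNW w) = [.corner, .corner] := by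
  have hr' := rootedFace_rowMirrorDom w hr
  have h' := ω.mirrorFar_isB2a hr h
  have hh' : holeFaceW w ∉ rowMirrorDom w D := by rwa [mem_rowMirrorDom, mirrorRowFace_holeFaceW]
  have hK' : killSW w ∉ rowMirrorDom w D := by rwa [mem_rowMirrorDom, mirrorRowFace_killSW]
  have hcol' : ∀ y : ℤ, 2 * w.2 - Y ≤ y → y ≤ w.2 - 3 →
      ((w.1 - 3, y) : Face) ∉ rowMirrorDom w D ∨ ((w.1 - 2, y) : Face) ∉ rowMirrorDom w D := by
    intro y hy1 hy2
    rw [mem_rowMirrorDom, mem_rowMirrorDom, mirrorRowFace_mkMO, mirrorRowFace_mkMO]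
    exact hcol (2 * w.2 - y) (by omega) (by omega)
  have hfloor' : ∀ f : Face, f ∈ rowMirrorDom w D → 2 * w.2 - Y ≤ f.2 := by
    intro f hf
    rw [mem_rowMirrorDom] at hf
    have := hceil _ hf
    obtain ⟨x, y⟩ := f
    rw [mirrorRowFace_mkMO] at this
    simp only at this ⊢
    omega
  have hS' : ω.mirrorFar.2.firstSideG = .S := by rw [mirrorFar_firstSideG, hN]; rfl
  have hk := kindsIn_farSW_eq_of_wound_under_killSW_column hh' hK' (Y := 2 * w.2 - Y) (by omega) hcol' hfloor'
    ω.mirrorFar hr' h' hS' (ω.mirrorFar_wound hr h hW)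
  have hk2 := ω.kindsIn_eq_corner_of_mirrorFar_coCorner hk
  rwa [mirrorRowFace_farSW] at hk2

/-- ★★★★★ **`K_N1` ON THE WEST WALL ⇒ EVERY WOUND OVER-WALK DOUBLES `farNW` THROUGH ITS TWO `θ`-CORNERS** (hole and `killNW w` absent,
no face of `D` in the columns `< w.1 − 3`). [cite: GlazmanManolescu2019, §1, Fig. 1, remark after eq. (1), §4.2 (lattice symmetries)]
[cite: Glazman2015WeightedSAW, Lemma 3.1 (proof, pp. 6–7)] [cite: CourantRobbins1958, Ch. V Appendix §2 (the even–odd rule)] -/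
theorem kindsIn_farNW_eq_of_wound_over_killNW_westWall (hh : holeFaceW w ∉ D) (hK : killNW w ∉ D)
    (hwest : ∀ f : Face, f ∈ D → w.1 - 3 ≤ f.1)
    (ω : ΩG D (w.side .W) (farW w)) (hr : RootedFace D (w.side .W) (farW w)) (h : ω.IsB2a)
    (hN : ω.2.firstSideG = .N) {θ : ℝ}
    (hW : ω.WE (fun _ => θ) ≠ excursionWinding θ ω.2.firstSideG (ω.z1 hr h) ω.1) :
    ω.2.kindsIn (farNW w) = [.corner, .corner] := by
  have hr' := rootedFace_rowMirrorDom w hr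
  have h' := ω.mirrorFar_isB2a hr h
  have hh' : holeFaceW w ∉ rowMirrorDom w D := by rwa [mem_rowMirrorDom, mirrorRowFace_holeFaceW]
  have hK' : killSW w ∉ rowMirrorDom w D := by rwa [mem_rowMirrorDom, mirrorRowFace_killSW]
  have hwest' : ∀ f : Face, f ∈ rowMirrorDom w D → w.1 - 3 ≤ f.1 := by
    intro f hf
    rw [mem_rowMirrorDom] at hf
    have := hwest _ hf
    obtain ⟨x, y⟩ := f
    rw [mirrorRowFace_mkMO] at this
    exact this
  have hS' : ω.mirrorFar.2.firstSideG = .S := by rw [mirrorFar_firstSideG, hN]; rfl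
  have hk := kindsIn_farSW_eq_of_wound_under_killSW_westWall hh' hK' hwest' ω.mirrorFar hr' h' hS'
    (ω.mirrorFar_wound hr h hW)
  have hk2 := ω.kindsIn_eq_corner_of_mirrorFar_coCorner hk
  rwa [mirrorRowFace_farSW] at hk2

/-- A rhombus with a two-entry kind list is visited. [cite: GlazmanManolescu2019, §1, Fig. 1] -/
private theorem mem_facesVisited_of_kindsIn_pair {ω : ΩG D (w.side .W) (farW w)} {g : Face} {κ : ArcKind}
    (hk : ω.2.kindsIn g = [κ, κ]) : g ∈ ω.2.facesVisited := by
  by_contra hn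
  rw [YBWalk.kindsIn_eq_nil hn] at hk
  exact List.cons_ne_nil _ _ hk.symm

/-- ★★★★★ **`K_N2` (column shut above, or the east wall) ⇒ every wound OVER-walk is `w₂`-marked off the far cell.**
[cite: GlazmanManolescu2019, §1 (the paragraph of Fig. 2), §4.2] [cite: Glazman2015WeightedSAW, Lemma 3.1 (proof, pp. 6–7)]
[cite: CourantRobbins1958, Ch. V Appendix §2 (the even–odd rule)] -/
theorem not_W2FreeOff_farW_of_wound_over_killNE (hh : holeFaceW w ∉ D) (hK : killNE w ∉ D)
    (hgeo : (∃ Y : ℤ, w.2 + 2 ≤ Y ∧ (∀ y : ℤ, w.2 + 3 ≤ y → y ≤ Y → ((w.1, y) : Face) ∉ D ∨ ((w.1 + 1, y) : Face) ∉ D) ∧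
        ∀ f : Face, f ∈ D → f.2 ≤ Y) ∨ ∀ f : Face, f ∈ D → f.1 < w.1 + 2)
    (ω : ΩG D (w.side .W) (farW w)) (hr : RootedFace D (w.side .W) (farW w)) (h : ω.IsB2a)
    (hN : ω.2.firstSideG = .N) {θ : ℝ}
    (hW : ω.WE (fun _ => θ) ≠ excursionWinding θ ω.2.firstSideG (ω.z1 hr h) ω.1) : ¬ω.2.W2FreeOff (farW w) := by
  have key : ω.2.kindsIn (rootN w) = [.coCorner, .coCorner] := by
    rcases hgeo with ⟨Y, hY, hcol, hceil⟩ | heast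
    · exact kindsIn_rootN_eq_of_wound_over_killNE_column hh hK hY hcol hceil ω hr h hN hW
    · exact kindsIn_rootN_eq_of_wound_over_killNE_eastWall hh hK heast ω hr h hN hW
  intro hfree
  exact hfree _ (mem_facesVisited_of_kindsIn_pair key) (rootN_ne_farW w) key

/-- ★★★★★ **`K_N1` (column shut above, or the west wall) ⇒ every wound OVER-walk is `w₁`-marked off the far cell.**
[cite: GlazmanManolescu2019, §1 (remark after eq. (1)), §4.2] [cite: Glazman2015WeightedSAW, Lemma 3.1 (proof, pp. 6–7)]
[cite: CourantRobbins1958, Ch. V Appendix §2 (the even–odd rule)] -/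
theorem not_W1FreeOff_farW_of_wound_over_killNW (hh : holeFaceW w ∉ D) (hK : killNW w ∉ D)
    (hgeo : (∃ Y : ℤ, w.2 + 2 ≤ Y ∧ (∀ y : ℤ, w.2 + 3 ≤ y → y ≤ Y → ((w.1 - 3, y) : Face) ∉ D ∨ ((w.1 - 2, y) : Face) ∉ D) ∧
        ∀ f : Face, f ∈ D → f.2 ≤ Y) ∨ ∀ f : Face, f ∈ D → w.1 - 3 ≤ f.1)
    (ω : ΩG D (w.side .W) (farW w)) (hr : RootedFace D (w.side .W) (farW w)) (h : ω.IsB2a)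
    (hN : ω.2.firstSideG = .N) {θ : ℝ}
    (hW : ω.WE (fun _ => θ) ≠ excursionWinding θ ω.2.firstSideG (ω.z1 hr h) ω.1) : ¬ω.2.W1FreeOff (farW w) := by
  have key : ω.2.kindsIn (farNW w) = [.corner, .corner] := by
    rcases hgeo with ⟨Y, hY, hcol, hceil⟩ | hwest
    · exact kindsIn_farNW_eq_of_wound_over_killNW_column hh hK hY hcol hceil ω hr h hN hW
    · exact kindsIn_farNW_eq_of_wound_over_killNW_westWall hh hK hwest ω hr h hN hW
  intro hfree
  exact hfree _ (mem_facesVisited_of_kindsIn_pair key) (farNW_ne_farW w) key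

end ΩG

end Literature.Probability.RandomPlanarGeometry.SAW.YangBaxter

namespace Literature.Barriers.CriticalPhenomena.PlaquetteWalk

open Literature.Probability.RandomPlanarGeometry.SAW.YangBaxter
open Real Complex

/-! ## §3 Boxes: the northern kill cells on a wall kill their freeness class whatever else is removed -/

section Boxes

variable {m n : ℕ} {S : List Face} {h : Face}

/-- ★★★★★ **ALL BOXES, ANY FURTHER DEFECTS: `K_N2 = (h.1 + 2, h.2 + 2)` REMOVED ON A WALL (`h.2 + 3 = n`: top wall; or `h.1 + 3 = m`:
east wall) ⇒ THE OVER ROUTE IS `w₂`-KILLED.** [cite: GlazmanManolescu2019, §1 (the paragraph of Fig. 2), Lemma 2.1, §4.2]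
[cite: Glazman2015WeightedSAW, Lemma 3.1 (proof, pp. 6–7)] [cite: CourantRobbins1958, Ch. V Appendix §2 (the even–odd rule)] -/
theorem lawL_box_killNE_wall_over_w2_killed (hW : 1 ≤ h.1) (hE : h.1 + 3 ≤ m) (hS0 : 0 ≤ h.2) (hN : h.2 + 3 ≤ n)
    (hbdry : h.2 + 3 = n ∨ h.1 + 3 = m) (hh : h ∈ S) (hfS : ((h.1 - 1, h.2) : Face) ∉ S)
    (hcK : ((h.1 + 2, h.2 + 2) : Face) ∈ S) (θ : ℝ) :
    ∀ (ω : ΩG (dom (boxMinus m n S)) (Face.side (h.1 + 1, h.2) .W) (farW (h.1 + 1, h.2))) (hb : ω.IsB2a),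
      ω.2.firstSideG = .N →
      ω.WE (fun _ => θ) ≠ excursionWinding θ ω.2.firstSideG
        (ω.z1 (rootedFace_hroot_boxMinus_of_mem (farW_hroot_mem_boxMinus_of_not_mem hW (by omega) hS0 (by omega) hfS) hh)
          hb) ω.1 →
      ¬ω.2.W2FreeOff (farW (h.1 + 1, h.2)) := by
  intro ω hb hN' hW'
  have hhD : holeFaceW ((h.1 + 1, h.2) : Face) ∉ dom (boxMinus m n S) := by
    rw [holeFaceW_hroot]; exact not_mem_dom_boxMinus_of_mem hh
  have hKD : killNE ((h.1 + 1, h.2) : Face) ∉ dom (boxMinus m n S) := by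
    have e : killNE ((h.1 + 1, h.2) : Face) = (h.1 + 2, h.2 + 2) := Prod.ext (by simp only [killNE]; ring) rfl
    rw [e]; exact not_mem_dom_boxMinus_of_mem hcK
  refine ΩG.not_W2FreeOff_farW_of_wound_over_killNE hhD hKD ?_ ω _ hb hN' hW'
  rcases hbdry with h3 | h3
  · refine Or.inl ⟨(n : ℤ) - 1, by simp only; omega, fun y hy hy' => by simp only at hy; omega, fun f hf => ?_⟩
    have := (mem_dom_boxMinus.1 hf).1.2.2.2; omega
  · refine Or.inr fun f hf => ?_
    have := (mem_dom_boxMinus.1 hf).1.2.1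
    simp only; omega

/-- ★★★★★ **ALL BOXES, ANY FURTHER DEFECTS: `K_N1 = (h.1 − 2, h.2 + 2)` REMOVED ON A WALL (`h.2 + 3 = n`: top wall; or `h.1 = 2`: west
wall) ⇒ THE OVER ROUTE IS `w₁`-KILLED.** [cite: GlazmanManolescu2019, §1 (remark after eq. (1)), Lemma 2.1, §4.2]
[cite: Glazman2015WeightedSAW, Lemma 3.1 (proof, pp. 6–7)] [cite: CourantRobbins1958, Ch. V Appendix §2 (the even–odd rule)] -/
theorem lawL_box_killNW_wall_over_w1_killed (hW : 2 ≤ h.1) (hE : h.1 ≤ m) (hS0 : 0 ≤ h.2) (hN : h.2 + 3 ≤ n)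
    (hbdry : h.2 + 3 = n ∨ h.1 = 2) (hh : h ∈ S) (hfS : ((h.1 - 1, h.2) : Face) ∉ S)
    (hcK : ((h.1 - 2, h.2 + 2) : Face) ∈ S) (θ : ℝ) :
    ∀ (ω : ΩG (dom (boxMinus m n S)) (Face.side (h.1 + 1, h.2) .W) (farW (h.1 + 1, h.2))) (hb : ω.IsB2a),
      ω.2.firstSideG = .N →
      ω.WE (fun _ => θ) ≠ excursionWinding θ ω.2.firstSideG
        (ω.z1 (rootedFace_hroot_boxMinus_of_mem (farW_hroot_mem_boxMinus_of_not_mem (by omega) hE hS0 (by omega) hfS) hh)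
          hb) ω.1 →
      ¬ω.2.W1FreeOff (farW (h.1 + 1, h.2)) := by
  intro ω hb hN' hW'
  have hhD : holeFaceW ((h.1 + 1, h.2) : Face) ∉ dom (boxMinus m n S) := by
    rw [holeFaceW_hroot]; exact not_mem_dom_boxMinus_of_mem hh
  have hKD : killNW ((h.1 + 1, h.2) : Face) ∉ dom (boxMinus m n S) := by
    have e : killNW ((h.1 + 1, h.2) : Face) = (h.1 - 2, h.2 + 2) := Prod.ext (by simp only [killNW]; ring) rfl
    rw [e]; exact not_mem_dom_boxMinus_of_mem hcK
  refine ΩG.not_W1FreeOff_farW_of_wound_over_killNW hhD hKD ?_ ω _ hb hN' hW'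
  rcases hbdry with h3 | h3
  · refine Or.inl ⟨(n : ℤ) - 1, by simp only; omega, fun y hy hy' => by simp only at hy; omega, fun f hf => ?_⟩
    have := (mem_dom_boxMinus.1 hf).1.2.2.2; omega
  · refine Or.inr fun f hf => ?_
    have := (mem_dom_boxMinus.1 hf).1.1
    simp only; omega

end Boxes

end Literature.Barriers.CriticalPhenomena.PlaquetteWalk
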